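import Summits.QuantumFields.BalabanUV.T4Continuum.Support.NE7BorderedHessianOnSlice
import Summits.QuantumFields.BalabanUV.T4Continuum.Support.NE7HessianFloorModGaugeSU2
import HarnessLib

/-!
# NE7BorderedHessianOnSliceSU2 — G12 WITH NO DISPLAYED HYPOTHESIS (d = 4, L = 2, SU(2)): `∃ ε₀ > 0 ∀ 0 < ε ≤ ε₀ ∀ N ≥ 1 ∀ j ∃ δ_V > 0 ∀ V₀ ∀ U♯ ∀ θ > 0 ∀ v ∃ X⋆` — the bordered Hessian of the
# constrained minimal action is attained on a multi-level slice representative `X⋆` whose Hessian term obeys the j-, N-uniform floor `Σ_P nhs(curl_{V₀}ṽ) ≤ ((1+θ)+2K·8C_P)·hess U♯ X̃⋆ X̃⋆ + 2Kρ‖ṽ‖²`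
# and whose scaled fine mass obeys `4^{−(j+1)}·dirSq X̃⋆ ≤ 16C_P·hess + 2ρ‖ṽ‖²` (`C_P = CPLine 4 2 2 10⁻¹⁷ 10⁻⁵³`, `ρ = 2liftMassC 4 2 + 4C_P liftCurlC 4 2`) — row NE3-R2's class slice
# Poincaré ✓ `classSlicePoincare_SU2` and every ε-line in numbers (G8's lemmas); so, for SU(2) at L = 2, (G′) IS REDUCED UNCONDITIONALLY TO ONE LETTER: the multiplier term on `X⋆`
# (lineage `b2b-balaban-t4-ne7-p1`, gen 118, file G13)

Cell `pub-balaban`, rung (B)+1 sub-cell t4, CRUX PROVER NE7 #1 (OWNER of row NE7), generation 118.  WHAT ([folklore]; 0 def, 0 sorry; `n : Type`, `card n = 2`):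
**`bordered_hessian_attained_on_slice_SU2`** = G12 ✓ `NE7BorderedHessianOnSlice.bordered_hessian_attained_on_slice` at `L = 2` with `ε₀ ≤ 10⁻⁵³`, the lines discharged by ✓
`NE7HessianFloorModGaugeSU2.mC_4_2_2_le`, ✓ `NE7RoutePiRegimeSU2.thetaLoc_4_2_lt`, `norm_num`, and `hSP` by ✓ `NE3ClassSlicePoincare.classSlicePoincare_SU2` at the minimiser (a class
configuration).
HONEST FRAMING: numeric instantiation of landed kernel theorems about OUR minimisers; the multiplier term is NOT bounded — (G′) NOT proved; nothing of Bałaban's asserted; NOT NE7 as a spine node;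
spine 0∕9; finite T⁴ rung (B)+1 — NOT infinite volume, NOT mass gap, NOT BetaPertH, NOT Clay.
-/

set_option autoImplicit false

open scoped BigOperators Matrix Matrix.Norms.L2Operator Topology
open NormedSpace Finset Set Filter Metric

namespace Summit.QuantumFields.BalabanUV.T4Continuum.NE7BorderedHessianOnSliceSU2

open Literature.MathematicalPhysics.QuantumFieldTheory.Balaban1983to89
open B7Prop1Explicit B7Prop2Explicit MatrixLog UnitaryModel
open T4AveragingDeficitWall (IsUnitaryCfg IsSkewDir SmallField curl dirSq)
open T4AveragingDeficitWallBoundary (IsPeriodicCfg periodBox)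
open AveragingDeficitTorusChart (TDir chart chartDir)
open AveragingDeficitTwoLevelPrep (twoLevelSmall skewSub)
open AveragingDeficitMultiLevelPrep (tower levelQ levelQ' LevelSmall)
open MatrixNorms (nhsNormSq)
open MinimalActionLevels (perWin stepWt)
open MinimalActionSandwich (IsMinimiser minAct)
open MinimalActionRate (sfClass)
open NE3HessForm (hess)
open NE7RadIterUniform (radD levelSmall_of_class_radius)
open NE7StraightTowerCurlEnergy (eC mC)
open NE3QbarIterCovLiftPrep (cruxC)
open NE3RightInverseSolveLetters (thetaLoc cruxC_le_thetaLoc cruxC_nonneg)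
open NE3SlicePoincareBudgetLine (CPLine)
open NE3ClassSlicePoincare (classSlicePoincare_SU2 lines_d4_L2_c2)
open NE3ClassRadiusFamily (CPLine_nonneg_d4_L2)
open NE7RoutePiRegimeSU2 (thetaLoc_4_2_lt thetaLoc_mul_lt_one)
open NE7SliceRepHessianFloor (liftMassC liftCurlC)
open NE7HessianFloorModGaugeSU2 (mC_4_2_2_le classRadius_eq_div)
open NE7BorderedHessianOnSlice (bordered_hessian_attained_on_slice)

noncomputable section

variable {n : Type} [Fintype n] [DecidableEq n]

/-- **THE BORDERED HESSIAN ATTAINED ON THE SLICE WITH THE FLOOR — SU(2), L = 2, NO DISPLAYED HYPOTHESIS** (see the module docstring). [cite: Balaban1985Variational, Thm 1 p.279, (83) p.290;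
Balaban1985Averaging, (48) p.25; Balaban1985PropagatorsII, Thm 3.3 (3.46)] -/
theorem bordered_hessian_attained_on_slice_SU2 [Nonempty n] (hn : Fintype.card n = 2) :
    ∃ ε₀ : ℝ, 0 < ε₀ ∧ ∀ ε : ℝ, 0 < ε → ε ≤ ε₀ →
      ∀ (N : ℕ) [NeZero N], 1 ≤ N → ∀ j : ℕ,
      ∃ δV : ℝ, 0 < δV ∧
        ∀ V₀ ∈ {V : Site 4 → Fin 4 → (Matrix n n ℂ)ˣ | IsUnitaryCfg V ∧ IsPeriodicCfg V (N : ℤ) ∧ SmallField V δV},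
        ∀ Us : Site 4 → Fin 4 → (Matrix n n ℂ)ˣ, IsMinimiser 4 (sfClass 4 2 N ε) 2 N (j + 1) V₀ Us → ∀ θ : ℝ, 0 < θ →
        ∀ v : ↥(skewSub 4 n N), ∃ Xs : ↥(skewSub 4 n (2 * tower 2 N j)),
          levelQ' 2 N j Us (Xs : TDir 4 n (2 * tower 2 N j)) = v
          ∧ fderiv ℝ (fderiv ℝ (fun y : ↥(skewSub 4 n N) => minAct 4 (sfClass 4 2 N ε) 2 N (j + 1) (chart (ContinuousLinearMap.id ℝ (Matrix n n ℂ)) N V₀ (y : TDir 4 n N)))) 0 v v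
              = ((stepWt 4 2)⁻¹) ^ (j + 1) * hess Us (chartDir (ContinuousLinearMap.id ℝ (Matrix n n ℂ)) (2 * tower 2 N j) (Xs : TDir 4 n (2 * tower 2 N j)))
                    (chartDir (ContinuousLinearMap.id ℝ (Matrix n n ℂ)) (2 * tower 2 N j) (Xs : TDir 4 n (2 * tower 2 N j))) (perWin 4 (tower 2 N (j + 1)))
                - fderiv ℝ (fun y : ↥(skewSub 4 n N) => minAct 4 (sfClass 4 2 N ε) 2 N (j + 1) (chart (ContinuousLinearMap.id ℝ (Matrix n n ℂ)) N V₀ (y : TDir 4 n N))) 0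
                    (fderiv ℝ (fderiv ℝ (fun Φ : ↥(skewSub 4 n (2 * tower 2 N j)) =>
                      levelQ 2 N j Us (chart (ContinuousLinearMap.id ℝ (Matrix n n ℂ)) (2 * tower 2 N j) Us (Φ : TDir 4 n (2 * tower 2 N j))))) 0 Xs Xs)
          ∧ ∑ P ∈ perWin 4 N, nhsNormSq (curl V₀ (chartDir (ContinuousLinearMap.id ℝ (Matrix n n ℂ)) N (v : TDir 4 n N)) P)
              ≤ ((1 + θ) + 2 * ((1 + θ) * (14 * (Fintype.card (T4AveragingDeficitWall.Plane 4) : ℝ) * ε) + (1 + θ⁻¹) * (36 * eC 4 2 (Fintype.card n) ^ 2 * ε ^ 2))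
                    * (4 * CPLine 4 2 2 (1 / 10 ^ 17) (1 / 10 ^ 53) * Fintype.card n))
                  * hess Us (chartDir (ContinuousLinearMap.id ℝ (Matrix n n ℂ)) (2 * tower 2 N j) (Xs : TDir 4 n (2 * tower 2 N j)))
                      (chartDir (ContinuousLinearMap.id ℝ (Matrix n n ℂ)) (2 * tower 2 N j) (Xs : TDir 4 n (2 * tower 2 N j))) (perWin 4 (tower 2 N (j + 1)))
                + 2 * ((1 + θ) * (14 * (Fintype.card (T4AveragingDeficitWall.Plane 4) : ℝ) * ε) + (1 + θ⁻¹) * (36 * eC 4 2 (Fintype.card n) ^ 2 * ε ^ 2))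
                    * ((2 * liftMassC 4 2 + 4 * CPLine 4 2 2 (1 / 10 ^ 17) (1 / 10 ^ 53) * liftCurlC 4 2)
                        * dirSq (chartDir (ContinuousLinearMap.id ℝ (Matrix n n ℂ)) N (v : TDir 4 n N)) (periodBox N))
          ∧ (((2 : ℕ) : ℝ)⁻¹) ^ (2 * (j + 1)) * dirSq (chartDir (ContinuousLinearMap.id ℝ (Matrix n n ℂ)) (2 * tower 2 N j) (Xs : TDir 4 n (2 * tower 2 N j))) (periodBox (tower 2 N (j + 1)))
              ≤ 2 * (4 * CPLine 4 2 2 (1 / 10 ^ 17) (1 / 10 ^ 53) * Fintype.card n)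
                  * hess Us (chartDir (ContinuousLinearMap.id ℝ (Matrix n n ℂ)) (2 * tower 2 N j) (Xs : TDir 4 n (2 * tower 2 N j)))
                      (chartDir (ContinuousLinearMap.id ℝ (Matrix n n ℂ)) (2 * tower 2 N j) (Xs : TDir 4 n (2 * tower 2 N j))) (perWin 4 (tower 2 N (j + 1)))
                + 2 * ((2 * liftMassC 4 2 + 4 * CPLine 4 2 2 (1 / 10 ^ 17) (1 / 10 ^ 53) * liftCurlC 4 2)
                    * dirSq (chartDir (ContinuousLinearMap.id ℝ (Matrix n n ℂ)) N (v : TDir 4 n N)) (periodBox N)) := by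
  obtain ⟨ε₁, hε₁, H⟩ := bordered_hessian_attained_on_slice (n := n) (L := 2) (by norm_num)
  refine ⟨min ε₁ (1 / 10 ^ 53), lt_min hε₁ (by norm_num), fun ε hε hεle N _ hN j => ?_⟩
  have hε' : ε ≤ 1 / 10 ^ 53 := hεle.trans (min_le_right _ _)
  have hε0 : 0 ≤ ε := hε.le
  -- the k-free ε-lines in numbers (d = 4, L = 2, card n = 2)
  have hεD2 : 4 * (2 * ε) * radD 4 2 * (((((2 : ℕ) : ℝ)) ^ 2)⁻¹) ^ 2 ≤ 1 := by
    have e : radD 4 2 = 370278400 := by unfold radD; norm_num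
    rw [e]; norm_num; linarith
  have hεT2 : twoLevelSmall 4 2 * (2 * (2 * ε) * ((((2 : ℕ) : ℝ)) ^ 2)⁻¹) ≤ 1 := by
    unfold twoLevelSmall; norm_num; linarith
  have hεM : 8 * (((2 : ℕ) : ℝ)) * mC 4 2 (Fintype.card n) * ε * ((((2 : ℕ) : ℝ)) ^ 2)⁻¹ ≤ 1 := by
    rw [hn]
    have hm := mC_4_2_2_le
    have e : 8 * (((2 : ℕ) : ℝ)) * mC 4 2 ((2 : ℕ) : ℝ) * ε * ((((2 : ℕ) : ℝ)) ^ 2)⁻¹ = 4 * (mC 4 2 2 * ε) := by push_cast; ring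
    rw [e]
    have : mC 4 2 2 * ε ≤ 2 * 10 ^ 15 * (1 / 10 ^ 53) := mul_le_mul hm hε' hε0 (by norm_num)
    linarith
  have hε1 : ε ≤ 1 := hε'.trans (by norm_num)
  have hθL := thetaLoc_4_2_lt
  have hθl2 : thetaLoc 4 2 * ε ≤ 1 / 2 := by
    have : thetaLoc 4 2 * ε ≤ 10 ^ 19 * (1 / 10 ^ 53) := mul_le_mul hθL.le hε' hε0 (by norm_num)
    linarith
  have hcrux : cruxC 4 2 * ε < 1 := lt_of_le_of_lt (mul_le_mul_of_nonneg_right (cruxC_le_thetaLoc 4 2) hε0) (thetaLoc_mul_lt_one hε hε')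
  have hEl : 43584 * ε ≤ 1 / 2 := by linarith
  obtain ⟨δV, hδV, hall⟩ := H ε hε (hεle.trans (min_le_left _ _)) hεD2 hεT2 hεM hε1 hcrux hθl2 hEl N hN j
  refine ⟨δV, hδV, fun V₀ hV₀ Us hUs θ hθ v => ?_⟩
  -- the slice Poincaré at the minimiser (a class configuration)
  have hεD : 4 * ε * radD 4 2 * (((((2 : ℕ) : ℝ)) ^ 2)⁻¹) ^ 2 ≤ 1 := by
    have e : radD 4 2 = 370278400 := by unfold radD; norm_num
    rw [e]; norm_num; linarith
  have hεT : twoLevelSmall 4 2 * (2 * ε * ((((2 : ℕ) : ℝ)) ^ 2)⁻¹) ≤ 1 := by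
    unfold twoLevelSmall; norm_num; linarith
  have hsmall : ∀ k : ℕ, LevelSmall 4 2 (k + 1) (ε / ((((2 : ℕ) : ℝ)) ^ (k + 2)) ^ 2) := by
    intro k
    rw [classRadius_eq_div]
    exact (levelSmall_of_class_radius (d := 4) (L := 2) (by norm_num) hε0 hεD hεT (k + 1)).1
  have hSP := classSlicePoincare_SU2 hn hN hε hε' hsmall j Us hUs.mem.1
  have hCP := CPLine_nonneg_d4_L2
  obtain ⟨-, -, -, -, hCPle⟩ := lines_d4_L2_c2
  have habs : 28 * (Fintype.card (T4AveragingDeficitWall.Plane 4) : ℝ) * ε * (4 * CPLine 4 2 2 (1 / 10 ^ 17) (1 / 10 ^ 53) * Fintype.card n) ≤ 1 := by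
    rw [hn, show Fintype.card (T4AveragingDeficitWall.Plane 4) = 6 from by rfl]
    have : ε * CPLine 4 2 2 (1 / 10 ^ 17) (1 / 10 ^ 53) ≤ (1 / 10 ^ 53) * (1234 * 10 ^ 14) := mul_le_mul hε' hCPle hCP (by norm_num)
    push_cast
    nlinarith
  exact hall V₀ hV₀ Us hUs _ hCP hSP habs θ hθ v

end

end Summit.QuantumFields.BalabanUV.T4Continuum.NE7BorderedHessianOnSliceSU2
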